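import Mathlib
import Summits.NavierStokesRegularity.NavierStokesRegularity.Theorems.EulerZoomLiouvillePowerGaugeEulerLiouvillePressureSlavingIsometry
import Literature.Analysis.FluidPDE.AxisymmetricTypeIOffAxis
import HarnessLib.Audit

/-!
# Crux E `EulerZoomLiouville.PowerGaugeEulerLiouville` — SEREGIN'S CLASS IS `O(3)`-INVARIANT: suitable weak
# solutions, weak spatial gradients and the power gauges `A`, `E`, `D` are covariant under every linear
# isometry `x ↦ R x`

Route №10 `EulerZoomLiouville` (NavierStokesRegularity), crux E = stmt-NavierStokesRegularity-19832.  Sequel of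
`…PressureSlavingIsometry` (ns-ezl-w3 g3: DISTRIBUTIONAL solutions are covariant, `PressureSlaving.isDistributional_conj_isometry`).
Here the remaining clauses of the crux class are transported along the conjugation
`(u, p, H) ↦ (R u(s, R⁻¹ x), p(s, R⁻¹ x), R ∘ H(s, R⁻¹ x) ∘ R⁻¹)`, `R : E ≃ₗᵢ[ℝ] E`:

* `hasWeakSpatialGradientOn_conj_isometry` — weak spatial gradients on a slab `S × E` (test pull-back
  `φ(s, R y)`, chain rule, `x = R y`);
* `isSuitableWeakSolutionOn_conj_isometry` — SUITABLE WEAK solutions on a slab (energy class, `L^{3/2}` pressure,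
  `L²` gradient and the LOCAL ENERGY INEQUALITY: every term of CKN (2.5) is a pointwise isometry invariant after
  `x = R y`; the Frobenius norm by `frobeniusNormSq_conj_linearIsometryEquiv`), any viscosity, any force;
* `cknA_conj_isometry`, `cknE_conj_isometry`, `cknD_conj_isometry` — the scaled quantities about the space–time
  origin are invariant (`Q_a(0)`, `B_a(0)` are `R`-invariant), hence `gauge_conj_isometry`: the crux's power-gauge
  inequality `a^{2ρ}A + a^{ρ}E + a^{2ρ}D ≤ c` is inherited verbatim.

Consequence (sequel file): every SYMMETRIC stratum of the crux class is conjugation-invariant — e.g. the axisymmetric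
swirl-free `C²` needle stratum (`…NeedleAxisymNoSwirlMember`) holds about ANY axis through the blow-up point.
NOT NS, not E: structural lemmas on the crux CLASS; 19832 OPEN.
References: Majda–Bertozzi 2002 §1.2 Prop. 1.1 (iii) [MajdaBertozziCUP2002]; CKN 1982 §2 (2.1)–(2.5)
[CaffarelliKohnNirenberg1982]; (change of variables under isometries) [folklore].
-/

noncomputable section

-- the summit and its single problem share the name `NavierStokesRegularity` (D-0017 nested layout)
set_option linter.dupNamespace false

open Set Filter Topology Metric Function MeasureTheory InnerProductSpace TopologicalSpace
open scoped RealInnerProductSpace NNReal ENNReal Laplacian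

namespace Summit.NavierStokesRegularity.NavierStokesRegularity.Theorems.PowerGaugeEulerLiouville.ClassIsometry

open Literature.Analysis Literature.Analysis.FluidPDE
open Summit.NavierStokesRegularity.NavierStokesRegularity.Theorems.PowerGaugeEulerLiouville.PressureSlaving

variable {E : Type*} [NormedAddCommGroup E] [InnerProductSpace ℝ E] [FiniteDimensional ℝ E]
  [MeasurableSpace E] [BorelSpace E]

/-! ### Small change-of-variables tools -/

/-- `∫ F(R y) dy = ∫ F(x) dx` for a linear isometry `R`. [folklore] -/
theorem integral_comp_isometry {G : Type*} [NormedAddCommGroup G] [NormedSpace ℝ G] (R : E ≃ₗᵢ[ℝ] E)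
    (F : E → G) : ∫ y, F (R y) = ∫ x, F x :=
  R.measurePreserving.integral_comp R.toHomeomorph.measurableEmbedding F

/-- `∫⁻ F(R y) dy = ∫⁻ F(x) dx` for a linear isometry `R`. [folklore] -/
theorem lintegral_comp_isometry (R : E ≃ₗᵢ[ℝ] E) (F : E → ℝ≥0∞) : ∫⁻ y, F (R y) = ∫⁻ x, F x :=
  R.measurePreserving.lintegral_comp_emb R.toHomeomorph.measurableEmbedding F

omit [FiniteDimensional ℝ E] [MeasurableSpace E] [BorelSpace E] in
/-- The preimage of a compact set under `(s, x) ↦ (s, R x)` is compact. [folklore] -/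
theorem isCompact_preimage_prod_isometry (R : E ≃ₗᵢ[ℝ] E) {K : Set (ℝ × E)} (hK : IsCompact K) :
    IsCompact ((fun z : ℝ × E => (z.1, R z.2)) ⁻¹' K) := by
  rw [← coe_prodCongr_isometry]
  exact ((Homeomorph.refl ℝ).prodCongr R.toHomeomorph).isCompact_preimage.2 hK

omit [FiniteDimensional ℝ E] [MeasurableSpace E] [BorelSpace E] in
/-- The preimage of a subset of a slab under `(s, x) ↦ (s, R x)` lies in the slab. [folklore] -/
theorem preimage_prod_isometry_subset_slab (R : E ≃ₗᵢ[ℝ] E) {S : Set ℝ} (hS : IsOpen S) {K : Set (ℝ × E)}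
    (hK : K ⊆ (slab E S hS : Set (ℝ × E))) :
    (fun z : ℝ × E => (z.1, R z.2)) ⁻¹' K ⊆ (slab E S hS : Set (ℝ × E)) := by
  intro z hz
  have h := hK hz
  rw [coe_slab] at h ⊢
  exact mem_prod.2 ⟨(mem_prod.1 h).1, mem_univ _⟩

/-- `∫⁻_K g(s, R⁻¹ x) = ∫⁻_{K₀} g` with `K₀ = {(s, y) : (s, R y) ∈ K}`. [folklore] -/
theorem setLIntegral_comp_symm_eq (R : E ≃ₗᵢ[ℝ] E) (g : ℝ × E → ℝ≥0∞) (K : Set (ℝ × E)) :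
    ∫⁻ z in K, g (z.1, R.symm z.2) = ∫⁻ w in (fun z : ℝ × E => (z.1, R z.2)) ⁻¹' K, g w := by
  have hpre : (fun z : ℝ × E => (z.1, R.symm z.2)) ⁻¹' ((fun z : ℝ × E => (z.1, R z.2)) ⁻¹' K) = K := by
    ext z; simp
  have h := (measurePreserving_prod_isometry R.symm).setLIntegral_comp_preimage_emb
    (measurableEmbedding_prod_isometry R.symm) g ((fun z : ℝ × E => (z.1, R z.2)) ⁻¹' K)
  rw [hpre] at h
  exact h

/-! ### Weak spatial gradients -/

/-- **Weak spatial gradients are covariant under linear isometries.**  If `H` is a weak spatial gradient of `u` on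
the slab `S × E`, then `(s, x) ↦ R ∘ H(s, R⁻¹ x) ∘ R⁻¹` is a weak spatial gradient of `(s, x) ↦ R u(s, R⁻¹ x)`.
[cite: CaffarelliKohnNirenberg1982, §2 eq. (2.1)] -/
theorem hasWeakSpatialGradientOn_conj_isometry {S : Set ℝ} (hS : IsOpen S) {u : ℝ → E → E}
    {H : ℝ → E → E →L[ℝ] E} (h : HasWeakSpatialGradientOn (slab E S hS) u H) (R : E ≃ₗᵢ[ℝ] E) :
    HasWeakSpatialGradientOn (slab E S hS) (fun s x => R (u s (R.symm x)))
      (fun s x => (R : E →L[ℝ] E).comp ((H s (R.symm x)).comp (R.symm : E →L[ℝ] E))) := by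
  refine ⟨?_, ?_, ?_⟩
  · -- local integrability of the conjugated field
    have h1 := h.locallyIntegrableOn
    rw [coe_slab] at h1 ⊢
    exact locallyIntegrableOn_clm_comp (R : E →L[ℝ] E) (locallyIntegrableOn_comp_prod_isometry R.symm h1)
  · -- local integrability of the conjugated gradient
    have h1 := h.locallyIntegrableOn_grad
    rw [coe_slab] at h1 ⊢
    set L : (E →L[ℝ] E) →L[ℝ] (E →L[ℝ] E) :=
      ((ContinuousLinearMap.compL ℝ E E E) (R : E →L[ℝ] E)).comp
        (((ContinuousLinearMap.compL ℝ E E E).flip) (R.symm : E →L[ℝ] E)) with hL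
    have h2 := locallyIntegrableOn_clm_comp L (locallyIntegrableOn_comp_prod_isometry R.symm h1)
    have hLA : ∀ A : E →L[ℝ] E, L A = (R : E →L[ℝ] E).comp (A.comp (R.symm : E →L[ℝ] E)) := fun A => by
      simp [hL]
    have hfun : (fun z : ℝ × E => L (uncurry H (z.1, R.symm z.2))) =
        uncurry (fun s x => (R : E →L[ℝ] E).comp ((H s (R.symm x)).comp (R.symm : E →L[ℝ] E))) := by
      funext z
      rw [hLA]
      rfl
    rw [hfun] at h2
    exact h2
  · -- integration by parts: pull the test function back along `(s, y) ↦ (s, R y)`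
    intro φ hφ v w
    have hφ' := isSpaceTimeTestOn_comp_isometry hS hφ R
    have key := h.integral_fderiv_mul_inner_eq (fun s y => φ s (R y)) hφ' (R.symm v) (R.symm w)
    -- left side: `∫ x, ∂_v φ(t,x) ⟪R u(t,R⁻¹x), w⟫ = ∫ y, ∂_{R⁻¹v} φ'(t,y) ⟪u(t,y), R⁻¹w⟫`
    have hL : ∀ t, ∫ x, fderiv ℝ (φ t) x v * ⟪R (u t (R.symm x)), w⟫ =
        ∫ y, fderiv ℝ (fun y => φ t (R y)) y (R.symm v) * ⟪u t y, R.symm w⟫ := by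
      intro t
      rw [← integral_comp_isometry R (fun x => fderiv ℝ (φ t) x v * ⟪R (u t (R.symm x)), w⟫)]
      refine integral_congr_ae (Eventually.of_forall fun y => ?_)
      have hfd : fderiv ℝ (fun y => φ t (R y)) y (R.symm v) = fderiv ℝ (φ t) (R y) v := by
        rw [show (fun y => φ t (R y)) = φ t ∘ (R.toContinuousLinearEquiv : E → E) from rfl,
          ContinuousLinearEquiv.comp_right_fderiv]
        simp
      simp only [R.symm_apply_apply, hfd]
      rw [← R.inner_map_map (u t y) (R.symm w), R.apply_symm_apply]
    -- right side
    have hR : ∀ t, ∫ x, φ t x * ⟪((R : E →L[ℝ] E).comp ((H t (R.symm x)).comp (R.symm : E →L[ℝ] E))) v, w⟫ =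
        ∫ y, φ t (R y) * ⟪H t y (R.symm v), R.symm w⟫ := by
      intro t
      rw [← integral_comp_isometry R (fun x => φ t x *
        ⟪((R : E →L[ℝ] E).comp ((H t (R.symm x)).comp (R.symm : E →L[ℝ] E))) v, w⟫)]
      refine integral_congr_ae (Eventually.of_forall fun y => ?_)
      have happ : ((R : E →L[ℝ] E).comp ((H t (R.symm (R y))).comp (R.symm : E →L[ℝ] E))) v =
          R (H t y (R.symm v)) := by
        simp
      dsimp only
      rw [happ, ← R.inner_map_map (H t y (R.symm v)) (R.symm w), R.apply_symm_apply]
    simp_rw [hL, hR]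
    exact key

/-! ### Suitable weak solutions -/

/-- **SUITABLE WEAK SOLUTIONS ARE COVARIANT UNDER LINEAR ISOMETRIES** (any viscosity, any force): if `(u, p)` is a
suitable weak solution (CKN (2.1)–(2.5)) with force `f` on the slab `S × E`, so is the conjugated triple
`(R u(s, R⁻¹ x), p(s, R⁻¹ x), R f(s, R⁻¹ x))`.  Energy class, `L^{3/2}` pressure and `L²` gradient transport along the
measure-preserving map `(s, x) ↦ (s, R x)`; in the local energy inequality every term is a pointwise invariant at
`x = R y` (`|R v| = |v|`, `|R A R⁻¹|_F = |A|_F`, `∂ₜ`, `Δ`, `∇` of the pulled-back test function).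
[cite: CaffarelliKohnNirenberg1982, §2 eq. (2.1)-(2.5); MajdaBertozziCUP2002, §1.2 Prop. 1.1 (iii)] -/
theorem isSuitableWeakSolutionOn_conj_isometry {S : Set ℝ} (hS : IsOpen S) {ν : ℝ} {f u : ℝ → E → E}
    {p : ℝ → E → ℝ} (h : IsSuitableWeakSolutionOn (slab E S hS) ν f u p) (R : E ≃ₗᵢ[ℝ] E) :
    IsSuitableWeakSolutionOn (slab E S hS) ν (fun s x => R (f s (R.symm x))) (fun s x => R (u s (R.symm x)))
      (fun s x => p s (R.symm x)) := by
  refine ⟨isDistributional_conj_isometry hS h.distributional R, ?_, ?_, ?_⟩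
  · -- energy class
    intro K hK hKc
    obtain ⟨C, hC⟩ := h.energyClass _ (preimage_prod_isometry_subset_slab R hS hK)
      (isCompact_preimage_prod_isometry R hKc)
    refine ⟨C, ?_⟩
    filter_upwards [hC] with t ht
    have hpt : ∀ x, K.indicator (fun z : ℝ × E => ‖R (u z.1 (R.symm z.2))‖ₑ ^ 2) (t, x) =
        ((fun z : ℝ × E => (z.1, R z.2)) ⁻¹' K).indicator (fun z : ℝ × E => ‖u z.1 z.2‖ₑ ^ 2) (t, R.symm x) := by
      intro x
      have hmem : (t, x) ∈ K ↔ (t, R.symm x) ∈ (fun z : ℝ × E => (z.1, R z.2)) ⁻¹' K := by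
        simp
      by_cases hx : (t, x) ∈ K
      · rw [indicator_of_mem hx, indicator_of_mem (hmem.1 hx)]
        simp only [R.enorm_map]
      · rw [indicator_of_notMem hx, indicator_of_notMem (fun h' => hx (hmem.2 h'))]
    calc ∫⁻ x, K.indicator (fun z : ℝ × E => ‖R (u z.1 (R.symm z.2))‖ₑ ^ 2) (t, x)
        = ∫⁻ x, ((fun z : ℝ × E => (z.1, R z.2)) ⁻¹' K).indicator (fun z : ℝ × E => ‖u z.1 z.2‖ₑ ^ 2)
            (t, R.symm x) := lintegral_congr hpt
      _ = ∫⁻ y, ((fun z : ℝ × E => (z.1, R z.2)) ⁻¹' K).indicator (fun z : ℝ × E => ‖u z.1 z.2‖ₑ ^ 2) (t, y) :=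
          lintegral_comp_isometry R.symm
            (fun y => ((fun z : ℝ × E => (z.1, R z.2)) ⁻¹' K).indicator (fun z : ℝ × E => ‖u z.1 z.2‖ₑ ^ 2) (t, y))
      _ ≤ C := ht
  · -- `L^{3/2}` pressure
    intro K hK hKc
    have h1 := h.pressure _ (preimage_prod_isometry_subset_slab R hS hK) (isCompact_preimage_prod_isometry R hKc)
    have h2 := setLIntegral_comp_symm_eq R (fun w : ℝ × E => ‖p w.1 w.2‖ₑ ^ (3 / 2 : ℝ)) K
    dsimp only at h2
    rw [h2]
    exact h1
  · -- weak gradient, its `L²_loc` bound, and the local energy inequality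
    obtain ⟨G, hG, hGL2, hLEI⟩ := h.localEnergy
    refine ⟨fun s x => (R : E →L[ℝ] E).comp ((G s (R.symm x)).comp (R.symm : E →L[ℝ] E)),
      hasWeakSpatialGradientOn_conj_isometry hS hG R, ?_, ?_⟩
    · intro K hK hKc
      have h1 := hGL2 _ (preimage_prod_isometry_subset_slab R hS hK) (isCompact_preimage_prod_isometry R hKc)
      have h2 := setLIntegral_comp_symm_eq R (fun w : ℝ × E => ENNReal.ofReal (frobeniusNormSq (G w.1 w.2))) K
      dsimp only at h2
      simp_rw [frobeniusNormSq_conj_linearIsometryEquiv]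
      rw [h2]
      exact h1
    · intro φ hφ hφ0
      have hφ' := isSpaceTimeTestOn_comp_isometry hS hφ R
      have key := hLEI (fun s y => φ s (R y)) hφ' (fun t y => hφ0 t (R y))
      -- left-hand side at `x = R y`
      have hLHS : ∫ t, ∫ x, frobeniusNormSq ((R : E →L[ℝ] E).comp ((G t (R.symm x)).comp (R.symm : E →L[ℝ] E))) *
            φ t x = ∫ t, ∫ y, frobeniusNormSq (G t y) * φ t (R y) := by
        congr 1
        funext t
        rw [← integral_comp_isometry R (fun x =>
          frobeniusNormSq ((R : E →L[ℝ] E).comp ((G t (R.symm x)).comp (R.symm : E →L[ℝ] E))) * φ t x)]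
        refine integral_congr_ae (Eventually.of_forall fun y => ?_)
        simp only [R.symm_apply_apply, frobeniusNormSq_conj_linearIsometryEquiv]
      -- right-hand side at `x = R y`, term by term
      have hRHS : ∫ t, ∫ x, (‖R (u t (R.symm x))‖ ^ 2 * (timeDeriv φ t x + ν * (Δ (φ t)) x) +
            (‖R (u t (R.symm x))‖ ^ 2 + 2 * p t (R.symm x)) * ⟪R (u t (R.symm x)), gradient (φ t) x⟫ +
            2 * ⟪R (f t (R.symm x)), R (u t (R.symm x))⟫ * φ t x) =
          ∫ t, ∫ y, (‖u t y‖ ^ 2 * (timeDeriv (fun s y => φ s (R y)) t y + ν * (Δ (fun y => φ t (R y))) y) +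
            (‖u t y‖ ^ 2 + 2 * p t y) * ⟪u t y, gradient (fun y => φ t (R y)) y⟫ +
            2 * ⟪f t y, u t y⟫ * φ t (R y)) := by
        congr 1
        funext t
        conv_lhs => rw [← integral_comp_isometry R]
        refine integral_congr_ae (Eventually.of_forall fun y => ?_)
        have e2 : timeDeriv φ t (R y) = timeDeriv (fun s y => φ s (R y)) t y := rfl
        have e3 : (Δ (φ t)) (R y) = (Δ (fun y => φ t (R y))) y := by
          have h3 := laplacian_comp_linearIsometryEquiv_symm R.symm (φ t) y
          simp only [LinearIsometryEquiv.symm_symm] at h3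
          exact h3.symm
        have e4 : gradient (φ t) (R y) = R (gradient (fun y => φ t (R y)) y) := by
          rw [gradient_comp_isometry R (φ t) y, R.apply_symm_apply]
        simp only [R.symm_apply_apply, R.norm_map, R.inner_map_map, e2, e3, e4]
      dsimp only
      rw [hLHS, hRHS]
      exact key

/-! ### The power gauges about the origin -/

/-- `A(a; 0)` is invariant: `B_a(0)` is `R`-invariant and `|R v| = |v|`. [cite: CaffarelliKohnNirenberg1982, §2 after eq. (2.6)] -/
theorem cknA_conj_isometry (R : E ≃ₗᵢ[ℝ] E) (a : ℝ) (u : ℝ → E → E) :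
    cknA a (0 : ℝ × E) (fun s x => R (u s (R.symm x))) = cknA a (0 : ℝ × E) u := by
  unfold cknA
  refine iSup_congr fun t => iSup_congr fun _ => ?_
  congr 1
  have hpre : (R.symm : E → E) ⁻¹' ball (0 : E) a = ball 0 a := by
    rw [R.symm.preimage_ball, R.symm_symm, map_zero]
  have h1 := R.symm.measurePreserving.setLIntegral_comp_preimage_emb R.symm.toHomeomorph.measurableEmbedding
    (fun x => ‖u t x‖ₑ ^ 2) (ball (0 : E) a)
  rw [hpre] at h1
  simp only [Prod.snd_zero, R.enorm_map]
  exact h1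

/-- `E(a; 0; ·)` is invariant: `Q_a(0)` is invariant and `|R A R⁻¹|_F = |A|_F`. [cite: CaffarelliKohnNirenberg1982, §2 (δ(r))] -/
theorem cknE_conj_isometry (R : E ≃ₗᵢ[ℝ] E) (a : ℝ) (H : ℝ → E → E →L[ℝ] E) :
    cknE a (0 : ℝ × E) (fun s x => (R : E →L[ℝ] E).comp ((H s (R.symm x)).comp (R.symm : E →L[ℝ] E))) =
      cknE a (0 : ℝ × E) H := by
  unfold cknE
  congr 1
  simp_rw [frobeniusNormSq_conj_linearIsometryEquiv]
  have hpre : (fun z : ℝ × E => (z.1, R z.2)) ⁻¹' parabolicCylinder a (0 : ℝ × E) = parabolicCylinder a 0 := by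
    ext z
    simp [mem_parabolicCylinder]
  have h2 := setLIntegral_comp_symm_eq R (fun w : ℝ × E => ENNReal.ofReal (frobeniusNormSq (H w.1 w.2)))
    (parabolicCylinder a (0 : ℝ × E))
  rw [hpre] at h2
  exact h2

/-- `D(a; 0)` is invariant: `Q_a(0)` is `R`-invariant. [cite: CaffarelliKohnNirenberg1982, §2 eq. (2.3)] -/
theorem cknD_conj_isometry (R : E ≃ₗᵢ[ℝ] E) (a : ℝ) (p : ℝ → E → ℝ) :
    cknD a (0 : ℝ × E) (fun s x => p s (R.symm x)) = cknD a (0 : ℝ × E) p := by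
  unfold cknD
  congr 1
  have hpre : (fun z : ℝ × E => (z.1, R z.2)) ⁻¹' parabolicCylinder a (0 : ℝ × E) = parabolicCylinder a 0 := by
    ext z
    simp [mem_parabolicCylinder]
  have h2 := setLIntegral_comp_symm_eq R (fun w : ℝ × E => ‖p w.1 w.2‖ₑ ^ (3 / 2 : ℝ))
    (parabolicCylinder a (0 : ℝ × E))
  rw [hpre] at h2
  exact h2

/-- **THE CRUX CLASS IS `O(3)`-INVARIANT: the power-gauge inequality is inherited verbatim.** If
`a^{2ρ}A(a;0;u) + a^{ρ}E(a;0;H) + a^{2ρ}D(a;0;p) ≤ c` for all `a > 0`, the same holds for the conjugated triple.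
[cite: CaffarelliKohnNirenberg1982, §2] -/
theorem gauge_conj_isometry (R : E ≃ₗᵢ[ℝ] E) {ρ : ℝ} {c : ℝ≥0∞} {u : ℝ → E → E} {p : ℝ → E → ℝ}
    {H : ℝ → E → E →L[ℝ] E}
    (hgauge : ∀ a : ℝ, 0 < a →
      ENNReal.ofReal (a ^ (2 * ρ)) * cknA a (0 : ℝ × E) u + ENNReal.ofReal (a ^ ρ) * cknE a (0 : ℝ × E) H +
        ENNReal.ofReal (a ^ (2 * ρ)) * cknD a (0 : ℝ × E) p ≤ c) :
    ∀ a : ℝ, 0 < a →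
      ENNReal.ofReal (a ^ (2 * ρ)) * cknA a (0 : ℝ × E) (fun s x => R (u s (R.symm x))) +
          ENNReal.ofReal (a ^ ρ) *
            cknE a (0 : ℝ × E) (fun s x => (R : E →L[ℝ] E).comp ((H s (R.symm x)).comp (R.symm : E →L[ℝ] E))) +
        ENNReal.ofReal (a ^ (2 * ρ)) * cknD a (0 : ℝ × E) (fun s x => p s (R.symm x)) ≤ c := by
  intro a ha
  rw [cknA_conj_isometry, cknE_conj_isometry, cknD_conj_isometry]
  exact hgauge a ha

end Summit.NavierStokesRegularity.NavierStokesRegularity.Theorems.PowerGaugeEulerLiouville.ClassIsometry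

end
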